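import Summits.Ventures.LatticeQCDFlow.Scoring.InfiniteVolumeWilsonLoops2D
import Summits.Ventures.LatticeQCDFlow.Scoring.TorusAreaLaw2DIrreducible
import Summits.Ventures.LatticeQCDFlow.Scoring.TiltedMeanStrictMono
import HarnessLib

/-!
# The exact non-abelian area law in two dimensions, V-n: EVERY NON-TRIVIAL IRREDUCIBLE REPRESENTATION OF EVERY COMPACT GROUP CONFINES IN INFINITE VOLUME, WITH THE EXACT STRING TENSION `−log|P_ρ(β)|`

HONEST FRAMING: exact (Metropolis-corrected) sampling algorithms for lattice gauge theory;
figures of merit are autocorrelation/cost numbers at stated couplings and volumes; no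
continuum-physics claim.

Venture `LatticeQCDFlow` (cell pub-lqcd), sub-topic `Scoring`; FANOUT row 5 (`s0-sun-a`), GEN-19.
NEW WORK of the cell (placement rule).  `G` compact metrisable, `ρ : G →* M_N(ℂ)` continuous with trivial
commutant (`IsIrreducibleFamily ρ` — every irreducible `ρ`, Schur) and not the trivial representation; the
two-dimensional `ρ`-Wilson-action lattice gauge theory (theory-2's `wilsonMeasure ρ β`), Wilson loops in `ρ`
(`χ = N⁻¹ Re tr ρ`), EVERY real `β`.  The ONE-PLAQUETTE PLAQUETTE of `ρ` is the tilted mean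
`P_ρ(β) = ∫ N⁻¹ Re tr ρ(g) e^{−β(N − Re tr ρ(g))} dg / ∫ e^{−β(N − Re tr ρ(g))} dg`.

* (§1 = `TiltedMeanStrictMono`: the tilted mean of a bounded observable is strictly increasing off point masses;)
* §2 the one-plaquette scalar of `ρ`: `integral_trace_mul_eq_ofReal'` (`∫ tr ρ · w ∈ ℝ` for every continuous `ρ`
  of a compact group and inversion-symmetric `w`), `integral_rep_apply_eq_zero_of_irreducible` (`∫ ρ(g) dg = 0`),
  `integralMatrix_eq_smul_of_irreducible` (`∫ ρ w_β = (N⁻¹ ∫ Re tr ρ · w_β)·1`, a REAL scalar),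
  `exists_trace_re_lt_of_irreducible`, and the range of the plaquette: `irreducible_plaquette_zero` (`P_ρ(0) = 0`),
  `strictMono_irreducible_plaquette`, `irreducible_plaquette_ne_zero_abs_lt_one` (`0 < |P_ρ(β)| < 1` for `β ≠ 0`);
* §3 **`irreducible_rectExpectation_eq`** — for every infinite-volume limit point `μ` and `R, T ≥ 1`:
  `W_μ(R,T) = P_ρ(β)^{RT}`; for `β ≠ 0`: **`irreducible_hasStaticPotential`** (`V(R) = −R log|P_ρ(β)|`),
  **`irreducible_hasStringTension`** / `'` (`σ_ρ(β) = −log|P_ρ(β)|`), **`irreducible_isConfining`**, and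
  **`irreducible_infiniteVolume_confinement`** — THE infinite-volume limit `μ_β` (unique, V-k) of the 2-d lattice
  gauge theory of ANY non-trivial irreducible representation of ANY compact metrisable group CONFINES at every
  `β ≠ 0` with exactly linear static potential and string tension `−log|P_ρ(β)| > 0`.

No `def`, nothing cited as a fact, 0 sorry.
-/

noncomputable section

open MeasureTheory ProbabilityTheory Function Finset Filter Topology
open Literature.MathematicalPhysics.QuantumFieldTheory
open Literature.MathematicalPhysics.QuantumLattice
open Literature.RepresentationTheory.CompactGroups
open Summit.Ventures.LatticeQCDFlow.Theory2.Lattice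
open Summit.Ventures.LatticeQCDFlow.Theory2.Lattice.TwoDim

namespace Summit.Ventures.LatticeQCDFlow.Scoring

/-! ## §2. The one-plaquette scalar and plaquette of an irreducible representation -/

section Scalar

variable {G : Type*} [Group G] [TopologicalSpace G] [IsTopologicalGroup G]
  [CompactSpace G] [SecondCountableTopology G] [MeasurableSpace G] [BorelSpace G] {N : ℕ}
  (ρ : G →* Matrix (Fin N) (Fin N) ℂ)

omit [SecondCountableTopology G] in
/-- `∫ tr ρ(u) w(u) du` IS REAL for every continuous representation of a compact group and every continuous
inversion-symmetric weight (`tr ρ(u⁻¹) = conj tr ρ(u)`, inversion invariance of Haar). -/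
theorem integral_trace_mul_eq_ofReal' (hρ : Continuous ρ) {w : G → ℝ} (hw : Continuous w)
    (hwi : ∀ u, w u⁻¹ = w u) :
    ∫ u, (ρ u).trace * (w u : ℂ) ∂(haarProbability G) =
      ((∫ u, (ρ u).trace.re * w u ∂(haarProbability G) : ℝ) : ℂ) := by
  have hcont : Continuous fun u : G => (ρ u).trace * (w u : ℂ) :=
    (hρ.matrix_trace).mul (Complex.continuous_ofReal.comp hw)
  set c := ∫ u, (ρ u).trace * (w u : ℂ) ∂(haarProbability G) with hc
  have hconj : (starRingEnd ℂ) c = c := by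
    rw [hc, ← integral_conj]
    have h1 : ∀ u : G, (starRingEnd ℂ) ((ρ u).trace * (w u : ℂ)) = (ρ u⁻¹).trace * (w u⁻¹ : ℂ) := fun u => by
      rw [map_mul, Complex.conj_ofReal, hwi, CompactGroup.trace_map_inv ρ hρ]
    simp_rw [h1]
    exact integral_inv_eq_self (fun u => (ρ u).trace * (w u : ℂ)) (haarProbability G)
  have hre : c.re = ∫ u, (ρ u).trace.re * w u ∂(haarProbability G) := by
    rw [hc]
    have h := integral_re (integrable_haarProbability_of_continuous hcont)
    simp only [RCLike.re_to_complex] at h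
    rw [← h]
    refine integral_congr_ae (ae_of_all _ fun u => ?_)
    simp only [Complex.mul_re, Complex.ofReal_re, Complex.ofReal_im, mul_zero, sub_zero]
  rw [← hre]
  exact (Complex.conj_eq_iff_re.mp hconj).symm

omit [SecondCountableTopology G] in
/-- **`∫ ρ(g) dg = 0`** for a continuous representation with trivial commutant which is not trivial: the
matrix `M₀ = ∫ ρ` commutes with `ρ` (it is the one-plaquette matrix of the weight `1`), hence is a scalar `c·1`,
and `ρ(h) M₀ = M₀` (left invariance), so `c (ρ(h) − 1) = 0` with `ρ(h) ≠ 1`. -/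
theorem integral_rep_apply_eq_zero_of_irreducible (hρ : Continuous ρ)
    (hirr : IsIrreducibleFamily fun g : G => ρ g) (hnt : ∃ g₀ : G, ρ g₀ ≠ 1) (k l : Fin N) :
    ∫ u, ρ u k l ∂(haarProbability G) = 0 := by
  obtain ⟨g₀, hg₀⟩ := hnt
  have hcomm := rep_mul_integralMatrix_comm ρ hρ (w := fun _ => (1 : ℝ)) continuous_const (fun _ _ => rfl)
  simp only [Complex.ofReal_one, mul_one] at hcomm
  obtain ⟨c, hc⟩ := hirr (Matrix.of fun k l : Fin N => ∫ u, ρ u k l ∂(haarProbability G))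
    (fun g => (hcomm g).symm)
  -- left invariance: `ρ(g₀) M₀ = M₀`
  have hleft : ρ g₀ * (Matrix.of fun k l : Fin N => ∫ u, ρ u k l ∂(haarProbability G)) =
      Matrix.of fun k l : Fin N => ∫ u, ρ u k l ∂(haarProbability G) := by
    ext a b
    rw [Matrix.mul_apply, Matrix.of_apply]
    simp only [Matrix.of_apply]
    have hint : ∀ j : Fin N, Integrable (fun u : G => ρ u j b) (haarProbability G) := fun j =>
      integrable_haarProbability_of_continuous (hρ.matrix_elem j b)
    calc ∑ j, ρ g₀ a j * ∫ u, ρ u j b ∂(haarProbability G)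
        = ∫ u, ∑ j, ρ g₀ a j * ρ u j b ∂(haarProbability G) := by
          rw [integral_finsetSum _ fun j _ => (hint j).const_mul _]
          exact Finset.sum_congr rfl fun j _ => (integral_const_mul _ _).symm
      _ = ∫ u, ρ (g₀ * u) a b ∂(haarProbability G) := by
          refine integral_congr_ae (ae_of_all _ fun u => ?_)
          simp only [map_mul, Matrix.mul_apply]
      _ = ∫ u, ρ u a b ∂(haarProbability G) := integral_mul_left_eq_self (fun u => ρ u a b) g₀
  rw [hc, Matrix.mul_smul, Matrix.mul_one] at hleft
  -- `c • ρ g₀ = c • 1` with `ρ g₀ ≠ 1` forces `c = 0`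
  have hc0 : c = 0 := by
    by_contra hne
    exact hg₀ (smul_right_injective (Matrix (Fin N) (Fin N) ℂ) hne hleft)
  have h := congr_fun (congr_fun hc k) l
  rw [Matrix.of_apply, hc0, zero_smul, Matrix.zero_apply] at h
  exact h

omit [SecondCountableTopology G] in
/-- Hence `∫ Re tr ρ(g) dg = 0` for a non-trivial representation with trivial commutant. -/
theorem integral_trace_re_eq_zero_of_irreducible (hρ : Continuous ρ)
    (hirr : IsIrreducibleFamily fun g : G => ρ g) (hnt : ∃ g₀ : G, ρ g₀ ≠ 1) :
    ∫ u, (ρ u).trace.re ∂(haarProbability G) = 0 := by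
  have hint : ∀ k : Fin N, Integrable (fun u : G => ρ u k k) (haarProbability G) := fun k =>
    integrable_haarProbability_of_continuous (hρ.matrix_elem k k)
  have htr : ∫ u, (ρ u).trace ∂(haarProbability G) = 0 := by
    calc ∫ u, (ρ u).trace ∂(haarProbability G) = ∫ u, ∑ k, ρ u k k ∂(haarProbability G) := by
          simp only [Matrix.trace, Matrix.diag_apply]
      _ = ∑ k, ∫ u, ρ u k k ∂(haarProbability G) := integral_finsetSum _ fun k _ => hint k
      _ = 0 := Finset.sum_eq_zero fun k _ => integral_rep_apply_eq_zero_of_irreducible ρ hρ hirr hnt k k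
  have h := integral_re (integrable_haarProbability_of_continuous hρ.matrix_trace) (𝕜 := ℂ)
  simp only [RCLike.re_to_complex] at h
  rw [h, htr, Complex.zero_re]

omit [SecondCountableTopology G] in
/-- **THE ONE-PLAQUETTE MATRIX OF AN IRREDUCIBLE REPRESENTATION IS A REAL SCALAR**:
`∫ ρ(g) e^{−β(N − Re tr ρ(g))} dg = (N⁻¹ ∫ Re tr ρ · e^{−β(N − Re tr ρ)})·1` (Schur + reality of `∫ tr ρ · w`). -/
theorem integralMatrix_eq_smul_of_irreducible [NeZero N] (hρ : Continuous ρ)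
    (hirr : IsIrreducibleFamily fun g : G => ρ g) (β : ℝ) :
    (Matrix.of fun k l : Fin N => ∫ g, ρ g k l *
      (Real.exp (-(β * ((N : ℝ) - (ρ g).trace.re))) : ℂ) ∂(haarProbability G)) =
      (((N : ℝ)⁻¹ * ∫ g, (ρ g).trace.re * Real.exp (-(β * ((N : ℝ) - (ρ g).trace.re)))
          ∂(haarProbability G) : ℝ) : ℂ) • (1 : Matrix (Fin N) (Fin N) ℂ) := by
  have hN : (N : ℂ) ≠ 0 := Nat.cast_ne_zero.2 (NeZero.ne N)
  have htr : Continuous fun g : G => (ρ g).trace.re := Complex.continuous_re.comp hρ.matrix_trace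
  have hw : Continuous fun g : G => Real.exp (-(β * ((N : ℝ) - (ρ g).trace.re))) := by
    have := htr
    fun_prop
  have hwc : ∀ k g : G, Real.exp (-(β * ((N : ℝ) - (ρ (k * g * k⁻¹)).trace.re))) =
      Real.exp (-(β * ((N : ℝ) - (ρ g).trace.re))) := fun k g => by
    rw [map_mul, map_mul, Matrix.trace_mul_cycle, ← map_mul, inv_mul_cancel, map_one, one_mul]
  have hwi : ∀ u : G, Real.exp (-(β * ((N : ℝ) - (ρ u⁻¹).trace.re))) =
      Real.exp (-(β * ((N : ℝ) - (ρ u).trace.re))) := fun u => by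
    rw [CompactGroup.re_trace_map_inv ρ hρ]
  obtain ⟨c, hc⟩ := hirr (Matrix.of fun k l : Fin N => ∫ g, ρ g k l *
      (Real.exp (-(β * ((N : ℝ) - (ρ g).trace.re))) : ℂ) ∂(haarProbability G))
    (fun g => (rep_mul_integralMatrix_comm ρ hρ hw hwc g).symm)
  -- the trace of the matrix: `c N = ∫ tr ρ · w = ↑(∫ Re tr ρ · w)`
  have hint : ∀ k : Fin N, Integrable (fun g : G => ρ g k k *
      (Real.exp (-(β * ((N : ℝ) - (ρ g).trace.re))) : ℂ)) (haarProbability G) := fun k =>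
    integrable_haarProbability_of_continuous ((hρ.matrix_elem k k).mul (Complex.continuous_ofReal.comp hw))
  have hMtrace : (Matrix.of fun k l : Fin N => ∫ g, ρ g k l *
      (Real.exp (-(β * ((N : ℝ) - (ρ g).trace.re))) : ℂ) ∂(haarProbability G)).trace =
      ∫ g, (ρ g).trace * (Real.exp (-(β * ((N : ℝ) - (ρ g).trace.re))) : ℂ) ∂(haarProbability G) := by
    symm
    calc ∫ g, (ρ g).trace * (Real.exp (-(β * ((N : ℝ) - (ρ g).trace.re))) : ℂ) ∂(haarProbability G)
        = ∫ g, ∑ k, ρ g k k * (Real.exp (-(β * ((N : ℝ) - (ρ g).trace.re))) : ℂ) ∂(haarProbability G) := by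
          refine integral_congr_ae (ae_of_all _ fun g => ?_)
          simp only [Matrix.trace, Matrix.diag_apply, Finset.sum_mul]
      _ = ∑ k, ∫ g, ρ g k k * (Real.exp (-(β * ((N : ℝ) - (ρ g).trace.re))) : ℂ) ∂(haarProbability G) :=
          integral_finsetSum _ fun k _ => hint k
      _ = _ := by simp only [Matrix.trace, Matrix.diag_apply, Matrix.of_apply]
  have hcN : c * (N : ℂ) = ((∫ g, (ρ g).trace.re * Real.exp (-(β * ((N : ℝ) - (ρ g).trace.re)))
      ∂(haarProbability G) : ℝ) : ℂ) := by
    have h := congrArg Matrix.trace hc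
    rw [hMtrace, Matrix.trace_smul, Matrix.trace_one, Fintype.card_fin, smul_eq_mul,
      integral_trace_mul_eq_ofReal' ρ hρ hw hwi] at h
    exact h.symm
  rw [hc]
  congr 1
  rw [Complex.ofReal_mul, Complex.ofReal_inv, Complex.ofReal_natCast, ← hcN]
  field_simp

omit [SecondCountableTopology G] [MeasurableSpace G] [BorelSpace G] in
/-- A non-trivial representation with trivial commutant takes some value with `Re tr ρ(g₀) < N`. -/
theorem exists_trace_re_lt_of_irreducible [NeZero N] (hρ : Continuous ρ)
    (hirr : IsIrreducibleFamily fun g : G => ρ g) (hnt : ∃ g₀ : G, ρ g₀ ≠ 1) :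
    ∃ g₀ : G, (ρ g₀).trace.re < N := by
  obtain hN1 | hN2 : N = 1 ∨ 2 ≤ N := by have := NeZero.pos N; omega
  · subst hN1
    obtain ⟨g₀, hg₀⟩ := hnt
    refine ⟨g₀, ?_⟩
    by_contra hge
    push Not at hge
    rw [Nat.cast_one] at hge
    have hnorm : ‖(ρ g₀).trace‖ ≤ 1 := by simpa using norm_trace_le_card ρ hρ g₀
    have hre : (ρ g₀).trace.re ≤ ‖(ρ g₀).trace‖ := Complex.re_le_norm _
    have hsq : ‖(ρ g₀).trace‖ ^ 2 = (ρ g₀).trace.re ^ 2 + (ρ g₀).trace.im ^ 2 := by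
      rw [← Complex.normSq_eq_norm_sq, Complex.normSq_apply]; ring
    have him : (ρ g₀).trace.im = 0 := by nlinarith [sq_nonneg (ρ g₀).trace.im]
    have hone : (ρ g₀).trace = 1 := Complex.ext (by simp; linarith) (by simpa using him)
    apply hg₀
    ext i j
    have hi : i = 0 := Subsingleton.elim _ _
    have hj : j = 0 := Subsingleton.elim _ _
    subst hi hj
    rw [Matrix.trace_fin_one] at hone
    rw [hone, Matrix.one_apply_eq]
  · obtain ⟨g₀, hg₀⟩ := exists_norm_trace_lt_of_isIrreducibleFamily ρ hN2 hρ hirr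
    exact ⟨g₀, lt_of_le_of_lt (Complex.re_le_norm _) hg₀⟩

omit [SecondCountableTopology G] in
/-- **`P_ρ(0) = 0`** for a non-trivial representation with trivial commutant. -/
theorem irreducible_plaquette_zero (hρ : Continuous ρ) (hirr : IsIrreducibleFamily fun g : G => ρ g)
    (hnt : ∃ g₀ : G, ρ g₀ ≠ 1) :
    (∫ g, (ρ g).trace.re / N * Real.exp (-((0 : ℝ) * ((N : ℝ) - (ρ g).trace.re))) ∂(haarProbability G)) /
        (∫ g, Real.exp (-((0 : ℝ) * ((N : ℝ) - (ρ g).trace.re))) ∂(haarProbability G)) = 0 := by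
  simp only [zero_mul, neg_zero, Real.exp_zero, mul_one]
  rw [div_eq_zero_iff]
  left
  have h := integral_trace_re_eq_zero_of_irreducible ρ hρ hirr hnt
  have hint : Integrable (fun g : G => (ρ g).trace.re) (haarProbability G) :=
    integrable_haarProbability_of_continuous (Complex.continuous_re.comp hρ.matrix_trace)
  calc ∫ g, (ρ g).trace.re / N ∂(haarProbability G) = (∫ g, (ρ g).trace.re ∂(haarProbability G)) / N := by
        simp_rw [div_eq_mul_inv]
        rw [integral_mul_const]
    _ = 0 := by rw [h, zero_div]

omit [SecondCountableTopology G] in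
/-- **`P_ρ` IS STRICTLY INCREASING IN `β`** for a non-trivial representation with trivial commutant
(`Re tr ρ ≤ N`, with `Re tr ρ(g₀) < N` somewhere and `Re tr ρ = N` at `1`; §1). -/
theorem strictMono_irreducible_plaquette [NeZero N] (hρ : Continuous ρ)
    (hirr : IsIrreducibleFamily fun g : G => ρ g) (hnt : ∃ g₀ : G, ρ g₀ ≠ 1) :
    StrictMono fun β : ℝ =>
      (∫ g, (ρ g).trace.re / N * Real.exp (-(β * ((N : ℝ) - (ρ g).trace.re))) ∂(haarProbability G)) /
        (∫ g, Real.exp (-(β * ((N : ℝ) - (ρ g).trace.re))) ∂(haarProbability G)) := by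
  have hN : (0 : ℝ) < N := Nat.cast_pos.2 (NeZero.pos N)
  have htr : Continuous fun g : G => (ρ g).trace.re := Complex.continuous_re.comp hρ.matrix_trace
  have hle : ∀ g : G, (ρ g).trace.re ≤ N := fun g => (Complex.re_le_norm _).trans (norm_trace_le_card ρ hρ g)
  have habs : ∀ g : G, |(ρ g).trace.re| ≤ N := fun g =>
    (Complex.abs_re_le_norm _).trans (norm_trace_le_card ρ hρ g)
  obtain ⟨g₀, hg₀⟩ := exists_trace_re_lt_of_irreducible ρ hρ hirr hnt
  refine strictMono_tilted_ratio htr.aestronglyMeasurable habs hN hle ?_ ?_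
  · exact (isOpen_lt htr continuous_const).measure_pos _ ⟨g₀, hg₀⟩
  · intro ε hε
    refine (isOpen_lt continuous_const htr).measure_pos _ ⟨1, ?_⟩
    simp only [Set.mem_setOf_eq, map_one, Matrix.trace_one, Fintype.card_fin, Complex.natCast_re]
    linarith

omit [SecondCountableTopology G] in
/-- **`P_ρ(β) ≠ 0` and `|P_ρ(β)| < 1` for `β ≠ 0`** (non-trivial `ρ` with trivial commutant). -/
theorem irreducible_plaquette_ne_zero_abs_lt_one [NeZero N] (hρ : Continuous ρ)
    (hirr : IsIrreducibleFamily fun g : G => ρ g) (hnt : ∃ g₀ : G, ρ g₀ ≠ 1) {β : ℝ} (hβ : β ≠ 0) :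
    (∫ g, (ρ g).trace.re / N * Real.exp (-(β * ((N : ℝ) - (ρ g).trace.re))) ∂(haarProbability G)) /
        (∫ g, Real.exp (-(β * ((N : ℝ) - (ρ g).trace.re))) ∂(haarProbability G)) ≠ 0 ∧
    |(∫ g, (ρ g).trace.re / N * Real.exp (-(β * ((N : ℝ) - (ρ g).trace.re))) ∂(haarProbability G)) /
        (∫ g, Real.exp (-(β * ((N : ℝ) - (ρ g).trace.re))) ∂(haarProbability G))| < 1 := by
  have hN : (0 : ℝ) < N := Nat.cast_pos.2 (NeZero.pos N)
  have htr : Continuous fun g : G => (ρ g).trace.re := Complex.continuous_re.comp hρ.matrix_trace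
  have hle : ∀ g : G, (ρ g).trace.re ≤ N := fun g => (Complex.re_le_norm _).trans (norm_trace_le_card ρ hρ g)
  have habs : ∀ g : G, |(ρ g).trace.re| ≤ N := fun g =>
    (Complex.abs_re_le_norm _).trans (norm_trace_le_card ρ hρ g)
  have hge : ∀ g : G, -(N : ℝ) ≤ (ρ g).trace.re := fun g => (abs_le.1 (habs g)).1
  obtain ⟨g₀, hg₀⟩ := exists_trace_re_lt_of_irreducible ρ hρ hirr hnt
  have hlt : 0 < haarProbability G {g | (ρ g).trace.re < N} :=
    (isOpen_lt htr continuous_const).measure_pos _ ⟨g₀, hg₀⟩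
  have hgt' : 0 < haarProbability G {g | -(N : ℝ) < (ρ g).trace.re} := by
    refine (isOpen_lt continuous_const htr).measure_pos _ ⟨1, ?_⟩
    simp only [Set.mem_setOf_eq, map_one, Matrix.trace_one, Fintype.card_fin, Complex.natCast_re]
    linarith
  refine ⟨?_, abs_lt.2 ⟨neg_one_lt_tilted_ratio htr.aestronglyMeasurable habs hN hge hgt' β,
    tilted_ratio_lt_one htr.aestronglyMeasurable habs hN hle hlt β⟩⟩
  have hmono := strictMono_irreducible_plaquette ρ hρ hirr hnt
  rcases lt_or_gt_of_ne hβ with h | h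
  · have h1 := hmono h
    dsimp only at h1
    rw [irreducible_plaquette_zero ρ hρ hirr hnt] at h1
    exact h1.ne
  · have h1 := hmono h
    dsimp only at h1
    rw [irreducible_plaquette_zero ρ hρ hirr hnt] at h1
    exact h1.ne'

end Scalar

/-! ## §3. The infinite-volume theory of an irreducible representation: exact loops and confinement -/

section InfiniteVolume

variable {G : Type*} [Group G] [TopologicalSpace G] [IsTopologicalGroup G]
  [CompactSpace G] [T2Space G] [SecondCountableTopology G] [MeasurableSpace G] [BorelSpace G] {N : ℕ}
  (ρ : G →* Matrix (Fin N) (Fin N) ℂ)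

omit [T2Space G] in
/-- **THE WILSON LOOPS OF THE INFINITE-VOLUME THEORY OF AN IRREDUCIBLE REPRESENTATION**: for every continuous
`ρ` with trivial commutant, every real `β`, every infinite-volume limit point `μ` and `R, T ≥ 1`:
`W_μ(R,T) = P_ρ(β)^{RT}`. -/
theorem irreducible_rectExpectation_eq [NeZero N] (hρ : Continuous ρ)
    (hirr : IsIrreducibleFamily fun g : G => ρ g) (β : ℝ) {μ : Measure (LGConfig 2 G)}
    (hμ : μ ∈ infiniteVolumeLimitPoints ρ β) {R T : ℕ} (hR1 : 1 ≤ R) (hT1 : 1 ≤ T) :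
    rectExpectation μ (fun g => normalisedCharacter N (ρ g)) 0 1 R T =
      ((∫ g, (ρ g).trace.re / N * Real.exp (-(β * ((N : ℝ) - (ρ g).trace.re))) ∂(haarProbability G)) /
        (∫ g, Real.exp (-(β * ((N : ℝ) - (ρ g).trace.re))) ∂(haarProbability G))) ^ (R * T) := by
  rw [rectExpectation_eq_re_pow_of_mem ρ hρ (integralMatrix_eq_smul_of_irreducible ρ hρ hirr β) hμ hR1 hT1,
    ← Complex.ofReal_div, ← Complex.ofReal_pow, Complex.ofReal_re]
  congr 2
  rw [← integral_const_mul]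
  refine integral_congr_ae (ae_of_all _ fun g => ?_)
  ring

omit [T2Space G] in
/-- **THE STATIC POTENTIAL IS EXACTLY LINEAR**, `V_μ(R) = −R log|P_ρ(β)|` (`β ≠ 0`, `ρ` non-trivial with trivial
commutant, every infinite-volume limit point, `R ≥ 1`). -/
theorem irreducible_hasStaticPotential [NeZero N] (hρ : Continuous ρ)
    (hirr : IsIrreducibleFamily fun g : G => ρ g) (hnt : ∃ g₀ : G, ρ g₀ ≠ 1) {β : ℝ} (hβ : β ≠ 0)
    {μ : Measure (LGConfig 2 G)} (hμ : μ ∈ infiniteVolumeLimitPoints ρ β) {R : ℕ} (hR1 : 1 ≤ R) :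
    HasStaticPotential μ (fun g => normalisedCharacter N (ρ g)) R
      (-(R * Real.log |(∫ g, (ρ g).trace.re / N * Real.exp (-(β * ((N : ℝ) - (ρ g).trace.re)))
          ∂(haarProbability G)) / (∫ g, Real.exp (-(β * ((N : ℝ) - (ρ g).trace.re))) ∂(haarProbability G))|)) :=
  hasStaticPotential_of_rectExpectation_eq_pow (irreducible_plaquette_ne_zero_abs_lt_one ρ hρ hirr hnt hβ).1 R
    fun _ hT => irreducible_rectExpectation_eq ρ hρ hirr β hμ hR1 hT

omit [T2Space G] in
/-- **THE STRING TENSION EXISTS AND EQUALS `−log|P_ρ(β)|`** (iterated form; `β ≠ 0`, every limit point). -/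
theorem irreducible_hasStringTension [NeZero N] (hρ : Continuous ρ)
    (hirr : IsIrreducibleFamily fun g : G => ρ g) (hnt : ∃ g₀ : G, ρ g₀ ≠ 1) {β : ℝ} (hβ : β ≠ 0)
    {μ : Measure (LGConfig 2 G)} (hμ : μ ∈ infiniteVolumeLimitPoints ρ β) :
    HasStringTension μ (fun g => normalisedCharacter N (ρ g))
      (-Real.log |(∫ g, (ρ g).trace.re / N * Real.exp (-(β * ((N : ℝ) - (ρ g).trace.re)))
          ∂(haarProbability G)) / (∫ g, Real.exp (-(β * ((N : ℝ) - (ρ g).trace.re))) ∂(haarProbability G))|) :=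
  hasStringTension_of_rectExpectation_eq_pow (irreducible_plaquette_ne_zero_abs_lt_one ρ hρ hirr hnt hβ).1
    fun _ _ hR hT => irreducible_rectExpectation_eq ρ hρ hirr β hμ hR hT

omit [T2Space G] in
/-- The joint-limit form of the string tension (`β ≠ 0`, every limit point). -/
theorem irreducible_hasStringTension' [NeZero N] (hρ : Continuous ρ)
    (hirr : IsIrreducibleFamily fun g : G => ρ g) (hnt : ∃ g₀ : G, ρ g₀ ≠ 1) {β : ℝ} (hβ : β ≠ 0)
    {μ : Measure (LGConfig 2 G)} (hμ : μ ∈ infiniteVolumeLimitPoints ρ β) :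
    HasStringTension' μ (fun g => normalisedCharacter N (ρ g))
      (-Real.log |(∫ g, (ρ g).trace.re / N * Real.exp (-(β * ((N : ℝ) - (ρ g).trace.re)))
          ∂(haarProbability G)) / (∫ g, Real.exp (-(β * ((N : ℝ) - (ρ g).trace.re))) ∂(haarProbability G))|) :=
  hasStringTension'_of_rectExpectation_eq_pow (irreducible_plaquette_ne_zero_abs_lt_one ρ hρ hirr hnt hβ).1
    fun _ _ hR hT => irreducible_rectExpectation_eq ρ hρ hirr β hμ hR hT

omit [T2Space G] in
/-- **CONFINEMENT**: positive string tension `−log|P_ρ(β)| > 0` (`β ≠ 0`, every limit point). -/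
theorem irreducible_isConfining [NeZero N] (hρ : Continuous ρ)
    (hirr : IsIrreducibleFamily fun g : G => ρ g) (hnt : ∃ g₀ : G, ρ g₀ ≠ 1) {β : ℝ} (hβ : β ≠ 0)
    {μ : Measure (LGConfig 2 G)} (hμ : μ ∈ infiniteVolumeLimitPoints ρ β) :
    IsConfining μ (fun g => normalisedCharacter N (ρ g)) :=
  isConfining_of_rectExpectation_eq_pow (irreducible_plaquette_ne_zero_abs_lt_one ρ hρ hirr hnt hβ).1
    (irreducible_plaquette_ne_zero_abs_lt_one ρ hρ hirr hnt hβ).2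
    fun _ _ hR hT => irreducible_rectExpectation_eq ρ hρ hirr β hμ hR hT

/-- **EVERY NON-TRIVIAL IRREDUCIBLE REPRESENTATION OF EVERY COMPACT METRISABLE GROUP CONFINES IN THE INFINITE-VOLUME
TWO-DIMENSIONAL LATTICE GAUGE THEORY, AT EVERY `β ≠ 0` — THE PACKAGE**: the infinite-volume limit `μ_β` of the
torus Wilson states exists and is the unique limit point (V-k); `W(R,T) = P_ρ(β)^{RT}`; exactly linear static
potential; string tension `−log|P_ρ(β)| > 0` in the iterated and joint senses; area law with `C = 1`. -/
theorem irreducible_infiniteVolume_confinement [NeZero N] (hρ : Continuous ρ)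
    (hirr : IsIrreducibleFamily fun g : G => ρ g) (hnt : ∃ g₀ : G, ρ g₀ ≠ 1) {β : ℝ} (hβ : β ≠ 0) :
    ∃ μ : Measure (LGConfig 2 G),
      Literature.MathematicalPhysics.QuantumLattice.IsInfiniteVolumeLimit ρ β μ ∧
      infiniteVolumeLimitPoints ρ β = {μ} ∧
      (∀ R T : ℕ, 1 ≤ R → 1 ≤ T → rectExpectation μ (fun g => normalisedCharacter N (ρ g)) 0 1 R T =
        ((∫ g, (ρ g).trace.re / N * Real.exp (-(β * ((N : ℝ) - (ρ g).trace.re))) ∂(haarProbability G)) /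
          (∫ g, Real.exp (-(β * ((N : ℝ) - (ρ g).trace.re))) ∂(haarProbability G))) ^ (R * T)) ∧
      IsConfining μ (fun g => normalisedCharacter N (ρ g)) ∧
      HasStringTension μ (fun g => normalisedCharacter N (ρ g))
        (-Real.log |(∫ g, (ρ g).trace.re / N * Real.exp (-(β * ((N : ℝ) - (ρ g).trace.re)))
            ∂(haarProbability G)) / (∫ g, Real.exp (-(β * ((N : ℝ) - (ρ g).trace.re))) ∂(haarProbability G))|) ∧
      HasStringTension' μ (fun g => normalisedCharacter N (ρ g))
        (-Real.log |(∫ g, (ρ g).trace.re / N * Real.exp (-(β * ((N : ℝ) - (ρ g).trace.re)))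
            ∂(haarProbability G)) / (∫ g, Real.exp (-(β * ((N : ℝ) - (ρ g).trace.re))) ∂(haarProbability G))|) ∧
      HasAreaLawState μ (fun g => normalisedCharacter N (ρ g)) := by
  obtain ⟨μ, -, hlimit, huniq, -, -⟩ := exists_infiniteVolumeLimit_two ρ hρ β
  have hμ : μ ∈ infiniteVolumeLimitPoints ρ β := hlimit.mem_infiniteVolumeLimitPoints
  exact ⟨μ, hlimit, huniq, fun R T hR hT => irreducible_rectExpectation_eq ρ hρ hirr β hμ hR hT,
    irreducible_isConfining ρ hρ hirr hnt hβ hμ, irreducible_hasStringTension ρ hρ hirr hnt hβ hμ,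
    irreducible_hasStringTension' ρ hρ hirr hnt hβ hμ,
    hasAreaLawState_of_rectExpectation_eq_pow (irreducible_plaquette_ne_zero_abs_lt_one ρ hρ hirr hnt hβ).1
      (irreducible_plaquette_ne_zero_abs_lt_one ρ hρ hirr hnt hβ).2
      fun _ _ hR hT => irreducible_rectExpectation_eq ρ hρ hirr β hμ hR hT⟩

end InfiniteVolume

end Summit.Ventures.LatticeQCDFlow.Scoring
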